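import Mathlib.MeasureTheory.Function.JacobianOneDim
import Mathlib.Analysis.SpecialFunctions.Trigonometric.Arctan
import Mathlib.Analysis.SpecialFunctions.Trigonometric.Deriv
import Mathlib.Analysis.Calculus.Deriv.MeanValue
import Mathlib.Analysis.SpecialFunctions.Sqrt
import Mathlib.Analysis.SpecialFunctions.ImproperIntegrals
import Literature.Analysis.Complex.SlitHalfStripMap
import HarnessLib

/-!
# The boundary integral of the slit-half-strip map in half-plane and strip coordinates

Topic `Literature/Analysis/Complex`. Sequel to `SlitHalfStripMap`: the angular average
`(2π)⁻¹ ∫_0^{2π} u(γ_{r,t}(θ)) dθ` of `log_normSq_add_le_average_slitStripBdry` is rewritten,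
by the change of variables `σ = cot(θ/2)` (the boundary correspondence of the Cayley map, under
which `dθ/2π` becomes the harmonic measure `dσ/(π(1+σ²))` of the upper half-plane at `i`), as
`π⁻¹ ∫_ℝ u(β_{r,t}(σ)) dσ/(1+σ²)` with the half-plane boundary parametrisation
`β_{r,t}(σ) = (r/π) log|1 - Aσ²| + i r·[Aσ² > 1]·sgn σ` of the boundary of the slit half-strip
`{|Im z| < r} ∖ (-∞, 0]` (`A = e^{πt/r} - 1`); cf. J. Bourgain, S. Dyatlov, *Spectral gaps
without the pressure condition*, Ann. of Math. 187 (2018), proof of Lemma 2.15, where the same map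
is used to estimate the harmonic measure of the slit strip. The change of variables is Mathlib's
`integral_image_eq_integral_abs_deriv_smul` (no inverse-function bookkeeping).

The second part rewrites the half-plane integral in the coordinate `x = Re z` of the four
boundary pieces — the two sides of the ray (`σ = ± S(x)`, `S(x) = ((1 - e^{πx/r})/A)^{1/2}`,
`x < 0`) and the two lines `Im z = ± r` (`σ = ± T(x)`, `T(x) = ((1 + e^{πx/r})/A)^{1/2}`) — giving
`∫_{x<0} u(x) ρ₀(x) dx + ∫ u(x+ir) ρ₁(x) dx + ∫ u(x-ir) ρ₁(x) dx` with the explicit densities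
`ρ₀ = rayDensity`, `ρ₁ = lineDensity` (`hpAverage_eq_densities`, `log_normSq_add_le_densities`):
BD18 (2.10) with explicit densities, harmonic-measure-free.
-/

noncomputable section

namespace Literature.Analysis.Complex

open _root_.Complex Metric Real MeasureTheory Filter Set
open scoped Topology

/-- `cot(θ/2)`, the boundary correspondence `e^{iθ} ↦ q = i cot(θ/2)` of the Cayley variable.
[cite: BourgainDyatlov2018, proof of Lemma 2.15] -/
def cotHalf (θ : ℝ) : ℝ := Real.cos (θ / 2) / Real.sin (θ / 2)

/-- `sin(θ/2) > 0` on `(0, 2π)`. [folklore] -/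
theorem sin_half_pos {θ : ℝ} (hθ : θ ∈ Ioo 0 (2 * π)) : 0 < Real.sin (θ / 2) :=
  Real.sin_pos_of_pos_of_lt_pi (by linarith [hθ.1]) (by linarith [hθ.2])

/-- `e^{iθ} ≠ 1` on `(0, 2π)`. [folklore] -/
theorem circleMap_ne_one {θ : ℝ} (hθ : θ ∈ Ioo 0 (2 * π)) : circleMap 0 1 θ ≠ 1 := by
  intro h
  have hre : Real.cos θ = 1 := by
    have := congrArg Complex.re h
    simpa [circleMap, Complex.exp_ofReal_mul_I_re] using this
  -- `cos θ = 1 - 2 sin²(θ/2)` with `sin(θ/2) > 0`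
  have h2 : Real.cos θ = 1 - 2 * Real.sin (θ / 2) ^ 2 := by
    have h3 : Real.cos θ = Real.cos (2 * (θ / 2)) := by ring_nf
    rw [h3, Real.cos_two_mul, Real.cos_sq']
    ring
  have hs := sin_half_pos hθ
  nlinarith

/-- `σ(θ) = cot(θ/2)` on `(0, 2π)`. [cite: BourgainDyatlov2018, proof of Lemma 2.15] -/
theorem bdrySigma_eq_cotHalf {θ : ℝ} (hθ : θ ∈ Ioo 0 (2 * π)) : bdrySigma θ = cotHalf θ := by
  have h1 := circleMap_ne_one hθ
  unfold bdrySigma cotHalf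
  rw [im_cayleyQ _ h1]
  have hsin : (circleMap 0 1 θ).im = Real.sin θ := by
    simp [circleMap, Complex.exp_ofReal_mul_I_im]
  have hns : Complex.normSq (1 - circleMap 0 1 θ) = 2 - 2 * Real.cos θ := by
    rw [Complex.normSq_apply]
    simp only [Complex.sub_re, Complex.one_re, Complex.sub_im, Complex.one_im]
    have hre : (circleMap 0 1 θ).re = Real.cos θ := by
      simp [circleMap, Complex.exp_ofReal_mul_I_re]
    rw [hre, hsin]
    nlinarith [Real.sin_sq_add_cos_sq θ]
  rw [hsin, hns]
  have hs := sin_half_pos hθ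
  have hsinθ : Real.sin θ = 2 * Real.sin (θ / 2) * Real.cos (θ / 2) := by
    rw [← Real.sin_two_mul]; ring_nf
  have hcosθ : 2 - 2 * Real.cos θ = 4 * Real.sin (θ / 2) ^ 2 := by
    have h3 : Real.cos θ = Real.cos (2 * (θ / 2)) := by ring_nf
    rw [h3, Real.cos_two_mul, Real.cos_sq']
    ring
  rw [hsinθ, hcosθ]
  field_simp
  ring

/-- `d/dθ cot(θ/2) = -(1 + cot²(θ/2))/2`. [folklore] -/
theorem hasDerivAt_cotHalf {θ : ℝ} (hs : Real.sin (θ / 2) ≠ 0) :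
    HasDerivAt cotHalf (-(1 + cotHalf θ ^ 2) / 2) θ := by
  have h1 : HasDerivAt (fun θ : ℝ => Real.cos (θ / 2)) (-Real.sin (θ / 2) * (1 / 2)) θ :=
    ((hasDerivAt_id θ).div_const 2).cos
  have h2 : HasDerivAt (fun θ : ℝ => Real.sin (θ / 2)) (Real.cos (θ / 2) * (1 / 2)) θ :=
    ((hasDerivAt_id θ).div_const 2).sin
  have h := h1.div h2 hs
  refine h.congr_deriv ?_
  unfold cotHalf
  have hsc := Real.sin_sq_add_cos_sq (θ / 2)
  have hs2 : Real.sin (θ / 2) ^ 2 ≠ 0 := pow_ne_zero 2 hs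
  rw [div_pow, div_eq_iff hs2] 
  rw [show -(1 + Real.cos (θ / 2) ^ 2 / Real.sin (θ / 2) ^ 2) / 2 * Real.sin (θ / 2) ^ 2 =
      -(Real.sin (θ / 2) ^ 2 + Real.cos (θ / 2) ^ 2) / 2 by field_simp]
  nlinarith [hsc]

/-- `cot(θ/2)` is strictly decreasing on `(0, 2π)`. [folklore] -/
theorem strictAntiOn_cotHalf : StrictAntiOn cotHalf (Ioo 0 (2 * π)) := by
  apply strictAntiOn_of_deriv_neg (convex_Ioo 0 (2 * π))
  · intro θ hθ
    exact (hasDerivAt_cotHalf (sin_half_pos hθ).ne').continuousAt.continuousWithinAt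
  · intro θ hθ
    rw [interior_Ioo] at hθ
    rw [(hasDerivAt_cotHalf (sin_half_pos hθ).ne').deriv]
    have : 0 ≤ cotHalf θ ^ 2 := sq_nonneg _
    linarith

/-- `cot(θ/2)` maps `(0, 2π)` onto `ℝ` (`θ = π - 2 arctan y ↦ y`). [folklore] -/
theorem cotHalf_image : cotHalf '' Ioo 0 (2 * π) = univ := by
  apply Set.eq_univ_of_forall
  intro y
  refine ⟨π - 2 * Real.arctan y, ⟨?_, ?_⟩, ?_⟩
  · linarith [Real.arctan_lt_pi_div_two y]
  · linarith [Real.neg_pi_div_two_lt_arctan y]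
  · unfold cotHalf
    have : (π - 2 * Real.arctan y) / 2 = π / 2 - Real.arctan y := by ring
    rw [this, Real.cos_pi_div_two_sub, Real.sin_pi_div_two_sub, ← Real.tan_eq_sin_div_cos,
      Real.tan_arctan]

/-- **The change of variables `σ = cot(θ/2)`**: for any `G : ℝ → ℝ`,
`∫_{(0,2π)} G(cot(θ/2)) dθ = ∫_ℝ 2 G(σ)/(1+σ²) dσ` (both sides being Bochner integrals, no
integrability hypothesis is needed). [folklore] -/
theorem integral_comp_cotHalf (G : ℝ → ℝ) :
    ∫ θ in Ioo 0 (2 * π), G (cotHalf θ) = ∫ σ, 2 / (1 + σ ^ 2) * G σ := by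
  have h := integral_image_eq_integral_abs_deriv_smul (s := Ioo 0 (2 * π)) (f := cotHalf)
    (f' := fun θ => -(1 + cotHalf θ ^ 2) / 2) measurableSet_Ioo
    (fun θ hθ => (hasDerivAt_cotHalf (sin_half_pos hθ).ne').hasDerivWithinAt)
    strictAntiOn_cotHalf.injOn (fun σ => 2 / (1 + σ ^ 2) * G σ)
  rw [cotHalf_image, Measure.restrict_univ] at h
  rw [h]
  refine setIntegral_congr_fun measurableSet_Ioo fun θ _ => ?_
  have hpos : 0 < 1 + cotHalf θ ^ 2 := by positivity
  rw [smul_eq_mul, abs_of_neg (by linarith [hpos] : -(1 + cotHalf θ ^ 2) / 2 < 0)]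
  field_simp

/-! ### The boundary integral in the half-plane variable `σ` -/

/-- The boundary of the slit half-strip parametrised by the half-plane variable `σ`
(`q = iσ`): `β(σ) = (r/π) log|1 - Aσ²| + i r·[Aσ² > 1]·sgn σ`.
[cite: BourgainDyatlov2018, proof of Lemma 2.15] -/
def hpBdry (r t σ : ℝ) : ℂ :=
  ((r / π * Real.log (1 - slitStripA r t * σ ^ 2) : ℝ) : ℂ) +
    (if 0 < 1 - slitStripA r t * σ ^ 2 then (0 : ℝ) else if 0 < σ then r else -r : ℝ) * Complex.I

/-- On `(0, 2π)`, `sin θ > 0 ↔ cot(θ/2) > 0`. [folklore] -/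
theorem sin_pos_iff_cotHalf_pos {θ : ℝ} (hθ : θ ∈ Ioo 0 (2 * π)) :
    0 < Real.sin θ ↔ 0 < cotHalf θ := by
  have hs := sin_half_pos hθ
  have hsinθ : Real.sin θ = 2 * Real.sin (θ / 2) * Real.cos (θ / 2) := by
    rw [← Real.sin_two_mul]; ring_nf
  unfold cotHalf
  rw [hsinθ]
  constructor
  · intro h
    apply div_pos _ hs
    by_contra hc
    push Not at hc
    have : 2 * Real.sin (θ / 2) * Real.cos (θ / 2) ≤ 0 :=
      mul_nonpos_of_nonneg_of_nonpos (by positivity) hc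
    linarith
  · intro h
    have hc : 0 < Real.cos (θ / 2) := by
      by_contra hc
      push Not at hc
      have : Real.cos (θ / 2) / Real.sin (θ / 2) ≤ 0 := div_nonpos_of_nonpos_of_nonneg hc hs.le
      linarith
    positivity

/-- `γ(θ) = β(cot(θ/2))` on `(0, 2π)`. [cite: BourgainDyatlov2018, proof of Lemma 2.15] -/
theorem slitStripBdry_eq_hpBdry {r t θ : ℝ} (hθ : θ ∈ Ioo 0 (2 * π)) :
    slitStripBdry r t θ = hpBdry r t (cotHalf θ) := by
  have hP : bdryP r t θ = 1 - slitStripA r t * cotHalf θ ^ 2 := by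
    unfold bdryP; rw [bdrySigma_eq_cotHalf hθ]
  unfold slitStripBdry hpBdry
  rw [hP]
  by_cases hs : 0 < Real.sin θ
  · have hc : 0 < cotHalf θ := (sin_pos_iff_cotHalf_pos hθ).1 hs
    simp only [hs, hc, if_true]
  · have hc : ¬ 0 < cotHalf θ := fun h => hs ((sin_pos_iff_cotHalf_pos hθ).2 h)
    simp only [hs, hc, if_false]

/-- **The angular average as a half-plane Poisson integral**: for any `u : ℂ → ℝ`,
`(2π)⁻¹ ∫_0^{2π} u(γ(θ)) dθ = π⁻¹ ∫_ℝ u(β(σ)) dσ/(1+σ²)` — `dσ/(π(1+σ²))` being the harmonic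
measure of the upper half-plane at `i`. [folklore] -/
theorem average_slitStripBdry_eq (r t : ℝ) (u : ℂ → ℝ) :
    (2 * π)⁻¹ * ∫ θ in (0 : ℝ)..2 * π, u (slitStripBdry r t θ) =
      π⁻¹ * ∫ σ, u (hpBdry r t σ) / (1 + σ ^ 2) := by
  rw [intervalIntegral.integral_of_le (le_of_lt two_pi_pos), integral_Ioc_eq_integral_Ioo]
  have h1 : ∫ θ in Ioo 0 (2 * π), u (slitStripBdry r t θ) =
      ∫ θ in Ioo 0 (2 * π), (fun σ => u (hpBdry r t σ)) (cotHalf θ) :=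
    setIntegral_congr_fun measurableSet_Ioo fun θ hθ => by
      simp only [slitStripBdry_eq_hpBdry hθ]
  rw [h1, integral_comp_cotHalf (fun σ => u (hpBdry r t σ))]
  have h2 : (fun σ => 2 / (1 + σ ^ 2) * u (hpBdry r t σ)) =
      fun σ => 2 * (u (hpBdry r t σ) / (1 + σ ^ 2)) := by
    funext σ; ring
  rw [h2, integral_const_mul]
  have hπ : (π : ℝ) ≠ 0 := Real.pi_pos.ne'
  field_simp

/-- **Sub-mean-value inequality in half-plane form**: for an entire `F` bounded on the open strip
`{|Im z| < r}`, `r, t, ε > 0`: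
`log(|F(t)|² + ε) ≤ π⁻¹ ∫_ℝ log(|F(β_{r,t}(σ))|² + ε) dσ/(1+σ²)`.
[cite: BourgainDyatlov2018, Lemmas 2.12 and 2.15] -/
theorem log_normSq_add_le_hpAverage {F : ℂ → ℂ} (hF : Differentiable ℂ F) {B r t ε : ℝ}
    (hB : ∀ z : ℂ, |z.im| < r → ‖F z‖ ≤ B) (hr : 0 < r) (ht : 0 < t) (hε : 0 < ε) :
    Real.log (‖F t‖ ^ 2 + ε) ≤
      π⁻¹ * ∫ σ, Real.log (‖F (hpBdry r t σ)‖ ^ 2 + ε) / (1 + σ ^ 2) := by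
  rw [← average_slitStripBdry_eq r t (fun z => Real.log (‖F z‖ ^ 2 + ε))]
  exact log_normSq_add_le_average_slitStripBdry hF hB hr ht hε

end Literature.Analysis.Complex

/-! ## Part 2: strip coordinates and explicit densities -/

namespace Literature.Analysis.Complex

open _root_.Complex Metric Real MeasureTheory Filter Set
open scoped Topology

/-- `S(x) = ((1 - e^{cx})/A)^{1/2}`: the half-plane parameter of the ray point `x < 0`
(`c = π/r`). [cite: BourgainDyatlov2018, proof of Lemma 2.15] -/
def rayParam (A c x : ℝ) : ℝ := Real.sqrt ((1 - Real.exp (c * x)) / A)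

/-- `T(x) = ((1 + e^{cx})/A)^{1/2}`: the half-plane parameter of the line point `x ± ir`.
[cite: BourgainDyatlov2018, proof of Lemma 2.15] -/
def lineParam (A c x : ℝ) : ℝ := Real.sqrt ((1 + Real.exp (c * x)) / A)

section params

variable {A c : ℝ} (hA : 0 < A) (hc : 0 < c)
include hA hc

omit hA in
/-- `0 < 1 - e^{cx} < 1` for `x < 0`. [folklore] -/
theorem one_sub_exp_mem {x : ℝ} (hx : x < 0) : 0 < 1 - Real.exp (c * x) ∧ 1 - Real.exp (c * x) < 1 := by
  have h1 : Real.exp (c * x) < 1 := by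
    rw [← Real.exp_zero]; exact Real.exp_lt_exp.2 (by nlinarith)
  exact ⟨by linarith, by linarith [Real.exp_pos (c * x)]⟩

/-- `S(x) > 0` for `x < 0`. [folklore] -/
theorem rayParam_pos {x : ℝ} (hx : x < 0) : 0 < rayParam A c x :=
  Real.sqrt_pos.2 (div_pos (one_sub_exp_mem hc hx).1 hA)

/-- `S(x)² = (1 - e^{cx})/A` for `x < 0`. [folklore] -/
theorem rayParam_sq {x : ℝ} (hx : x < 0) : rayParam A c x ^ 2 = (1 - Real.exp (c * x)) / A :=
  Real.sq_sqrt (div_pos (one_sub_exp_mem hc hx).1 hA).le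

/-- `1 - A S(x)² = e^{cx}`. [folklore] -/
theorem one_sub_mul_rayParam_sq {x : ℝ} (hx : x < 0) :
    1 - A * rayParam A c x ^ 2 = Real.exp (c * x) := by
  rw [rayParam_sq hA hc hx]; field_simp; ring

/-- `S(x) < A^{-1/2}` for `x < 0`. [folklore] -/
theorem rayParam_lt {x : ℝ} (hx : x < 0) : rayParam A c x < Real.sqrt A⁻¹ := by
  unfold rayParam
  apply Real.sqrt_lt_sqrt (div_pos (one_sub_exp_mem hc hx).1 hA).le
  rw [div_lt_iff₀ hA, inv_mul_cancel₀ hA.ne']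
  exact (one_sub_exp_mem hc hx).2

omit hc in
/-- `T(x) > 0`. [folklore] -/
theorem lineParam_pos (x : ℝ) : 0 < lineParam A c x :=
  Real.sqrt_pos.2 (div_pos (by linarith [Real.exp_pos (c * x)]) hA)

omit hc in
/-- `T(x)² = (1 + e^{cx})/A`. [folklore] -/
theorem lineParam_sq (x : ℝ) : lineParam A c x ^ 2 = (1 + Real.exp (c * x)) / A :=
  Real.sq_sqrt (div_pos (by linarith [Real.exp_pos (c * x)]) hA).le

omit hc in
/-- `1 - A T(x)² = -e^{cx}`. [folklore] -/
theorem one_sub_mul_lineParam_sq (x : ℝ) :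
    1 - A * lineParam A c x ^ 2 = -Real.exp (c * x) := by
  rw [lineParam_sq hA x]; field_simp; ring

omit hc in
/-- `T(x) > A^{-1/2}`. [folklore] -/
theorem lt_lineParam (x : ℝ) : Real.sqrt A⁻¹ < lineParam A c x := by
  unfold lineParam
  apply Real.sqrt_lt_sqrt (inv_nonneg.2 hA.le)
  rw [lt_div_iff₀ hA, inv_mul_cancel₀ hA.ne']
  linarith [Real.exp_pos (c * x)]

/-- Derivative of `S` on `x < 0`: `S'(x) = -c e^{cx}/(2 A S(x))`. [folklore] -/
theorem hasDerivAt_rayParam {x : ℝ} (hx : x < 0) :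
    HasDerivAt (rayParam A c) (-(c * Real.exp (c * x)) / (2 * A * rayParam A c x)) x := by
  have hin : HasDerivAt (fun x => (1 - Real.exp (c * x)) / A) (-(c * Real.exp (c * x)) / A) x := by
    have h1 : HasDerivAt (fun x => Real.exp (c * x)) (Real.exp (c * x) * c) x := by
      simpa using ((hasDerivAt_id x).const_mul c).exp
    refine ((h1.const_sub 1).div_const A).congr_deriv ?_
    ring
  have hne : (1 - Real.exp (c * x)) / A ≠ 0 := (div_pos (one_sub_exp_mem hc hx).1 hA).ne'
  have h := hin.sqrt hne
  refine h.congr_deriv ?_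
  unfold rayParam
  have hS : Real.sqrt ((1 - Real.exp (c * x)) / A) ≠ 0 :=
    (Real.sqrt_pos.2 (div_pos (one_sub_exp_mem hc hx).1 hA)).ne'
  field_simp

/-- Derivative of `T`: `T'(x) = c e^{cx}/(2 A T(x))`. [folklore] -/
theorem hasDerivAt_lineParam (x : ℝ) :
    HasDerivAt (lineParam A c) (c * Real.exp (c * x) / (2 * A * lineParam A c x)) x := by
  have hin : HasDerivAt (fun x => (1 + Real.exp (c * x)) / A) (c * Real.exp (c * x) / A) x := by
    have h1 : HasDerivAt (fun x => Real.exp (c * x)) (Real.exp (c * x) * c) x := by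
      simpa using ((hasDerivAt_id x).const_mul c).exp
    refine ((h1.const_add 1).div_const A).congr_deriv ?_
    ring
  have hne : (1 + Real.exp (c * x)) / A ≠ 0 := (div_pos (by linarith [Real.exp_pos (c * x)]) hA).ne'
  have h := hin.sqrt hne
  refine h.congr_deriv ?_
  unfold lineParam
  have hT : Real.sqrt ((1 + Real.exp (c * x)) / A) ≠ 0 :=
    (Real.sqrt_pos.2 (div_pos (by linarith [Real.exp_pos (c * x)]) hA)).ne'
  field_simp

/-- `S` is strictly decreasing on `x < 0`. [folklore] -/
theorem strictAntiOn_rayParam : StrictAntiOn (rayParam A c) (Iio 0) := by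
  intro x hx y hy hxy
  unfold rayParam
  apply Real.sqrt_lt_sqrt (div_pos (one_sub_exp_mem hc hy).1 hA).le
  apply div_lt_div_of_pos_right _ hA
  have : Real.exp (c * x) < Real.exp (c * y) := Real.exp_lt_exp.2 (by nlinarith)
  linarith

/-- `T` is strictly increasing. [folklore] -/
theorem strictMono_lineParam : StrictMono (lineParam A c) := by
  intro x y hxy
  unfold lineParam
  apply Real.sqrt_lt_sqrt (div_pos (by linarith [Real.exp_pos (c * x)]) hA).le
  apply div_lt_div_of_pos_right _ hA
  have : Real.exp (c * x) < Real.exp (c * y) := Real.exp_lt_exp.2 (by nlinarith)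
  linarith

/-- `S` maps `(-∞, 0)` onto `(0, A^{-1/2})`. [folklore] -/
theorem rayParam_image : rayParam A c '' Iio 0 = Ioo 0 (Real.sqrt A⁻¹) := by
  apply Subset.antisymm
  · rintro _ ⟨x, hx, rfl⟩
    exact ⟨rayParam_pos hA hc hx, rayParam_lt hA hc hx⟩
  · rintro σ ⟨h0, h1⟩
    have hσA : A * σ ^ 2 < 1 := by
      have h2 : σ ^ 2 < A⁻¹ := (Real.lt_sqrt h0.le).1 h1
      have := mul_lt_mul_of_pos_left h2 hA
      rwa [mul_inv_cancel₀ hA.ne'] at this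
    have hpos : 0 < 1 - A * σ ^ 2 := by linarith
    refine ⟨Real.log (1 - A * σ ^ 2) / c, ?_, ?_⟩
    · apply div_neg_of_neg_of_pos _ hc
      apply Real.log_neg hpos
      have : 0 < A * σ ^ 2 := by positivity
      linarith
    · unfold rayParam
      rw [mul_div_cancel₀ _ hc.ne', Real.exp_log hpos]
      have : (1 - (1 - A * σ ^ 2)) / A = σ ^ 2 := by field_simp; ring
      rw [this, Real.sqrt_sq h0.le]

/-- `T` maps `ℝ` onto `(A^{-1/2}, ∞)`. [folklore] -/
theorem lineParam_image : lineParam A c '' univ = Ioi (Real.sqrt A⁻¹) := by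
  apply Subset.antisymm
  · rintro _ ⟨x, -, rfl⟩
    exact lt_lineParam hA x
  · intro σ hσ
    have h0 : 0 < σ := lt_trans (Real.sqrt_pos.2 (inv_pos.2 hA)) hσ
    have hσA : 1 < A * σ ^ 2 := by
      have h2 : A⁻¹ < σ ^ 2 := (Real.sqrt_lt' h0).1 hσ
      have := mul_lt_mul_of_pos_left h2 hA
      rwa [mul_inv_cancel₀ hA.ne'] at this
    refine ⟨Real.log (A * σ ^ 2 - 1) / c, mem_univ _, ?_⟩
    unfold lineParam
    rw [mul_div_cancel₀ _ hc.ne', Real.exp_log (by linarith)]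
    have : (1 + (A * σ ^ 2 - 1)) / A = σ ^ 2 := by field_simp; ring
    rw [this, Real.sqrt_sq h0.le]

end params

/-! ### Densities in the strip coordinate -/

/-- The density of the boundary measure on the ray `(-∞, 0)` (both sides together):
`ρ₀(x) = r⁻¹ e^{πx/r} / (A S(x)(1 + S(x)²))`. [cite: BourgainDyatlov2018, Lemmas 2.13 and 2.15] -/
def rayDensity (r t x : ℝ) : ℝ :=
  1 / r * Real.exp (π / r * x) /
    (slitStripA r t * rayParam (slitStripA r t) (π / r) x *
      (1 + rayParam (slitStripA r t) (π / r) x ^ 2))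

/-- The density of the boundary measure on each of the lines `Im z = ± r`:
`ρ₁(x) = (2r)⁻¹ e^{πx/r} / (A T(x)(1 + T(x)²))`. [cite: BourgainDyatlov2018, Lemma 2.14] -/
def lineDensity (r t x : ℝ) : ℝ :=
  1 / (2 * r) * Real.exp (π / r * x) /
    (slitStripA r t * lineParam (slitStripA r t) (π / r) x *
      (1 + lineParam (slitStripA r t) (π / r) x ^ 2))

section strip

variable {r t : ℝ} (hr : 0 < r) (ht : 0 < t)
include hr ht

/-- `β(±S(x)) = x` for `x < 0` (a point of the ray). [folklore] -/
theorem hpBdry_rayParam {x : ℝ} (hx : x < 0) (s : ℝ) (hs : s = 1 ∨ s = -1) :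
    hpBdry r t (s * rayParam (slitStripA r t) (π / r) x) = (x : ℂ) := by
  have hA := slitStripA_pos hr ht
  have hc : 0 < π / r := by positivity
  have hsq : (s * rayParam (slitStripA r t) (π / r) x) ^ 2 =
      rayParam (slitStripA r t) (π / r) x ^ 2 := by
    rcases hs with h | h <;> simp [h]
  have h1 : 1 - slitStripA r t * (s * rayParam (slitStripA r t) (π / r) x) ^ 2 =
      Real.exp (π / r * x) := by
    rw [hsq, one_sub_mul_rayParam_sq hA hc hx]
  unfold hpBdry
  rw [h1, if_pos (Real.exp_pos _), Real.log_exp]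
  push_cast
  have hr' : (r : ℂ) ≠ 0 := by exact_mod_cast hr.ne'
  have hπ : (π : ℂ) ≠ 0 := by exact_mod_cast Real.pi_pos.ne'
  field_simp
  ring

/-- `β(T(x)) = x + ir`, `β(-T(x)) = x - ir` (points of the two lines). [folklore] -/
theorem hpBdry_lineParam (x : ℝ) (s : ℝ) (hs : s = 1 ∨ s = -1) :
    hpBdry r t (s * lineParam (slitStripA r t) (π / r) x) = (x : ℂ) + (s * r : ℝ) * Complex.I := by
  have hA := slitStripA_pos hr ht
  have hc : 0 < π / r := by positivity
  have hT := lineParam_pos hA (c := π / r) x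
  have hsq : (s * lineParam (slitStripA r t) (π / r) x) ^ 2 =
      lineParam (slitStripA r t) (π / r) x ^ 2 := by
    rcases hs with h | h <;> simp [h]
  have h1 : 1 - slitStripA r t * (s * lineParam (slitStripA r t) (π / r) x) ^ 2 =
      -Real.exp (π / r * x) := by
    rw [hsq, one_sub_mul_lineParam_sq hA x]
  unfold hpBdry
  rw [h1, if_neg (by linarith [Real.exp_pos (π / r * x)]), Real.log_neg_eq_log, Real.log_exp]
  have hsign : (if 0 < s * lineParam (slitStripA r t) (π / r) x then r else -r) = s * r := by
    rcases hs with h | h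
    · rw [h, one_mul, if_pos hT, one_mul]
    · rw [h, neg_one_mul, if_neg (by linarith), neg_one_mul]
  rw [hsign]
  push_cast
  have hr' : (r : ℂ) ≠ 0 := by exact_mod_cast hr.ne'
  have hπ : (π : ℂ) ≠ 0 := by exact_mod_cast Real.pi_pos.ne'
  congr 1
  field_simp

/-- The ray pieces: `∫_{±S(Iio 0)} h(σ) dσ = (π/2) ∫_{x<0} ρ₀(x) u(x) dx` for
`h(σ) = u(β(σ))/(1+σ²)`. [folklore] -/
theorem setIntegral_ray_piece (u : ℂ → ℝ) (s : ℝ) (hs : s = 1 ∨ s = -1) :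
    ∫ σ in (fun x => s * rayParam (slitStripA r t) (π / r) x) '' Iio 0,
        u (hpBdry r t σ) / (1 + σ ^ 2) =
      ∫ x in Iio 0, π / 2 * (rayDensity r t x * u x) := by
  have hA := slitStripA_pos hr ht
  have hc : 0 < π / r := by positivity
  have hs0 : |s| = 1 := by rcases hs with h | h <;> simp [h]
  rw [integral_image_eq_integral_abs_deriv_smul measurableSet_Iio
    (f' := fun x => s * (-(π / r * Real.exp (π / r * x)) /
      (2 * slitStripA r t * rayParam (slitStripA r t) (π / r) x)))
    (fun x hx => ((hasDerivAt_rayParam hA hc hx).const_mul s).hasDerivWithinAt)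
    (by
      have hinj := (strictAntiOn_rayParam hA hc).injOn
      intro x hx y hy hxy
      apply hinj hx hy
      have hs1 : s ≠ 0 := by rcases hs with h | h <;> simp [h]
      exact mul_left_cancel₀ hs1 hxy)]
  refine setIntegral_congr_fun measurableSet_Iio fun x hx => ?_
  have hS := rayParam_pos hA hc hx
  rw [hpBdry_rayParam hr ht hx s hs, smul_eq_mul, abs_mul, hs0, one_mul,
    abs_of_neg (by
      apply div_neg_of_neg_of_pos
      · have := Real.exp_pos (π / r * x); nlinarith [Real.pi_pos]
      · positivity)]
  have hsq : (s * rayParam (slitStripA r t) (π / r) x) ^ 2 =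
      rayParam (slitStripA r t) (π / r) x ^ 2 := by
    rcases hs with h | h <;> simp [h]
  rw [hsq]
  unfold rayDensity
  field_simp

/-- The line pieces: `∫_{±T(ℝ)} h(σ) dσ = π ∫ ρ₁(x) u(x ± ir) dx`. [folklore] -/
theorem setIntegral_line_piece (u : ℂ → ℝ) (s : ℝ) (hs : s = 1 ∨ s = -1) :
    ∫ σ in (fun x => s * lineParam (slitStripA r t) (π / r) x) '' univ,
        u (hpBdry r t σ) / (1 + σ ^ 2) =
      ∫ x, π * (lineDensity r t x * u ((x : ℂ) + (s * r : ℝ) * Complex.I)) := by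
  have hA := slitStripA_pos hr ht
  have hc : 0 < π / r := by positivity
  have hs0 : |s| = 1 := by rcases hs with h | h <;> simp [h]
  rw [integral_image_eq_integral_abs_deriv_smul MeasurableSet.univ
    (f' := fun x => s * (π / r * Real.exp (π / r * x) /
      (2 * slitStripA r t * lineParam (slitStripA r t) (π / r) x)))
    (fun x _ => ((hasDerivAt_lineParam hA hc x).const_mul s).hasDerivWithinAt)
    (by
      have hinj := (strictMono_lineParam hA hc).injective
      intro x _ y _ hxy
      apply hinj
      have hs1 : s ≠ 0 := by rcases hs with h | h <;> simp [h]
      exact mul_left_cancel₀ hs1 hxy),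
    Measure.restrict_univ]
  refine integral_congr_ae (Filter.Eventually.of_forall fun x => ?_)
  have hT := lineParam_pos hA (c := π / r) x
  simp only
  rw [hpBdry_lineParam hr ht x s hs, smul_eq_mul, abs_mul, hs0, one_mul,
    abs_of_pos (by positivity)]
  have hsq : (s * lineParam (slitStripA r t) (π / r) x) ^ 2 =
      lineParam (slitStripA r t) (π / r) x ^ 2 := by
    rcases hs with h | h <;> simp [h]
  rw [hsq]
  unfold lineDensity
  field_simp

/-- Images of the four parametrisations. [folklore] -/
theorem image_pieces :
    ((fun x => (1 : ℝ) * rayParam (slitStripA r t) (π / r) x) '' Iio 0 =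
        Ioo 0 (Real.sqrt (slitStripA r t)⁻¹)) ∧
      ((fun x => (-1 : ℝ) * rayParam (slitStripA r t) (π / r) x) '' Iio 0 =
        Ioo (-Real.sqrt (slitStripA r t)⁻¹) 0) ∧
      ((fun x => (1 : ℝ) * lineParam (slitStripA r t) (π / r) x) '' univ =
        Ioi (Real.sqrt (slitStripA r t)⁻¹)) ∧
      ((fun x => (-1 : ℝ) * lineParam (slitStripA r t) (π / r) x) '' univ =
        Iio (-Real.sqrt (slitStripA r t)⁻¹)) := by
  have hA := slitStripA_pos hr ht
  have hc : 0 < π / r := by positivity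
  have hR := rayParam_image hA hc
  have hL := lineParam_image hA hc
  refine ⟨?_, ?_, ?_, ?_⟩
  · simpa only [one_mul] using hR
  · ext σ
    simp only [neg_mul, one_mul, mem_image, mem_Iio, mem_Ioo]
    constructor
    · rintro ⟨x, hx, rfl⟩
      have : rayParam (slitStripA r t) (π / r) x ∈ Ioo 0 (Real.sqrt (slitStripA r t)⁻¹) := by
        rw [← hR]; exact ⟨x, hx, rfl⟩
      exact ⟨by linarith [this.2], by linarith [this.1]⟩
    · rintro ⟨h1, h2⟩
      have : -σ ∈ rayParam (slitStripA r t) (π / r) '' Iio 0 := by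
        rw [hR]; exact ⟨by linarith, by linarith⟩
      obtain ⟨x, hx, hxσ⟩ := this
      exact ⟨x, hx, by linarith⟩
  · simpa only [one_mul] using hL
  · ext σ
    simp only [neg_mul, one_mul, mem_image, mem_univ, true_and, mem_Iio]
    constructor
    · rintro ⟨x, rfl⟩
      have : lineParam (slitStripA r t) (π / r) x ∈ Ioi (Real.sqrt (slitStripA r t)⁻¹) := by
        rw [← hL]; exact ⟨x, mem_univ _, rfl⟩
      simp only [mem_Ioi] at this
      linarith
    · intro h
      have : -σ ∈ lineParam (slitStripA r t) (π / r) '' univ := by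
        rw [hL]; simp only [mem_Ioi]; linarith
      obtain ⟨x, -, hxσ⟩ := this
      exact ⟨x, by linarith⟩

/-- **The boundary integral in strip coordinates.** For `u : ℂ → ℝ` with
`σ ↦ u(β(σ))/(1+σ²)` integrable:
`π⁻¹ ∫ u(β(σ)) dσ/(1+σ²) = ∫_{x<0} ρ₀ u + ∫ ρ₁(x) u(x+ir) dx + ∫ ρ₁(x) u(x-ir) dx`.
[cite: BourgainDyatlov2018, §2.4] -/
theorem hpAverage_eq_densities (u : ℂ → ℝ)
    (hint : Integrable (fun σ => u (hpBdry r t σ) / (1 + σ ^ 2))) :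
    π⁻¹ * ∫ σ, u (hpBdry r t σ) / (1 + σ ^ 2) =
      (∫ x in Iio 0, rayDensity r t x * u x) +
        ((∫ x, lineDensity r t x * u ((x : ℂ) + r * Complex.I)) +
          ∫ x, lineDensity r t x * u ((x : ℂ) - r * Complex.I)) := by
  have hA := slitStripA_pos hr ht
  set a : ℝ := Real.sqrt (slitStripA r t)⁻¹ with ha
  have ha0 : 0 < a := Real.sqrt_pos.2 (inv_pos.2 hA)
  set h : ℝ → ℝ := fun σ => u (hpBdry r t σ) / (1 + σ ^ 2) with hh
  obtain ⟨hI1, hI2, hI3, hI4⟩ := image_pieces hr ht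
  -- the four pieces
  have hP1 : ∫ σ in Ioo 0 a, h σ = ∫ x in Iio 0, π / 2 * (rayDensity r t x * u x) := by
    rw [← hI1]; exact setIntegral_ray_piece hr ht u 1 (Or.inl rfl)
  have hP2 : ∫ σ in Ioo (-a) 0, h σ = ∫ x in Iio 0, π / 2 * (rayDensity r t x * u x) := by
    rw [← hI2]; exact setIntegral_ray_piece hr ht u (-1) (Or.inr rfl)
  have hP3 : ∫ σ in Ioi a, h σ = ∫ x, π * (lineDensity r t x * u ((x : ℂ) + r * Complex.I)) := by
    rw [← hI3, setIntegral_line_piece hr ht u 1 (Or.inl rfl)]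
    simp
  have hP4 : ∫ σ in Iio (-a), h σ = ∫ x, π * (lineDensity r t x * u ((x : ℂ) - r * Complex.I)) := by
    rw [← hI4, setIntegral_line_piece hr ht u (-1) (Or.inr rfl)]
    congr 1; funext x
    push_cast
    ring_nf
  -- splitting `∫ h`
  have hsplit0 : ∫ σ, h σ = (∫ σ in Iio 0, h σ) + ∫ σ in Ioi 0, h σ := by
    rw [← integral_add_compl (μ := volume) measurableSet_Iio hint, compl_Iio,
      integral_Ici_eq_integral_Ioi]
  have hsplit1 : ∫ σ in Iio 0, h σ = (∫ σ in Iio (-a), h σ) + ∫ σ in Ioo (-a) 0, h σ := by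
    rw [← integral_Ico_eq_integral_Ioo, ← setIntegral_union _ measurableSet_Ico
      hint.integrableOn hint.integrableOn, Iio_union_Ico_eq_Iio (by linarith)]
    exact Set.disjoint_left.2 fun x hx hx' => (not_le.2 (mem_Iio.1 hx)) hx'.1
  have hsplit2 : ∫ σ in Ioi 0, h σ = (∫ σ in Ioo 0 a, h σ) + ∫ σ in Ioi a, h σ := by
    rw [← integral_Ici_eq_integral_Ioi (x := a), ← setIntegral_union _ measurableSet_Ici
      hint.integrableOn hint.integrableOn, Ioo_union_Ici_eq_Ioi ha0]
    exact Set.disjoint_left.2 fun x hx hx' => (not_le.2 hx.2) hx'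
  rw [hsplit0, hsplit1, hsplit2, hP1, hP2, hP3, hP4, integral_const_mul, integral_const_mul,
    integral_const_mul]
  have hπ : (π : ℝ) ≠ 0 := Real.pi_pos.ne'
  field_simp
  ring

omit hr ht in
/-- `β` is measurable. [folklore] -/
theorem measurable_hpBdry : Measurable (hpBdry r t) := by
  unfold hpBdry
  refine Measurable.add (Complex.measurable_ofReal.comp ?_) (Measurable.mul
    (Complex.measurable_ofReal.comp ?_) measurable_const)
  · exact measurable_const.mul (Real.measurable_log.comp (measurable_const.sub
      (measurable_const.mul (measurable_id.pow_const 2))))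
  · refine Measurable.ite ?_ measurable_const (Measurable.ite ?_ measurable_const measurable_const)
    · exact measurableSet_lt measurable_const (measurable_const.sub
        (measurable_const.mul (measurable_id.pow_const 2)))
    · exact measurableSet_lt measurable_const measurable_id

omit ht in
/-- `β(σ)` lies in the closed strip `|Im z| ≤ r`. [folklore] -/
theorem abs_im_hpBdry_le (σ : ℝ) : |(hpBdry r t σ).im| ≤ r := by
  unfold hpBdry
  simp only [Complex.add_im, Complex.ofReal_im, Complex.mul_im, Complex.ofReal_re, Complex.I_re,
    Complex.I_im, mul_zero, mul_one, zero_add, add_zero]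
  split_ifs <;> simp [abs_of_pos hr, hr.le]

/-- **Sub-mean-value inequality with explicit densities** (harmonic-measure-free form of BD18
(2.10) on the slit half-strip `{|Im z| < r} ∖ (-∞, 0]`): for `F` entire and bounded on the
closed strip `{|Im z| ≤ r}`, `r, t, ε > 0`:
`log(|F(t)|² + ε) ≤ ∫_{x<0} ρ₀(x) log(|F(x)|²+ε) dx + ∫ ρ₁(x) log(|F(x+ir)|²+ε) dx
  + ∫ ρ₁(x) log(|F(x-ir)|²+ε) dx`. [cite: BourgainDyatlov2018, Lemma 2.12] -/
theorem log_normSq_add_le_densities {F : ℂ → ℂ} (hF : Differentiable ℂ F) {B ε : ℝ}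
    (hB : ∀ z : ℂ, |z.im| ≤ r → ‖F z‖ ≤ B) (hε : 0 < ε) :
    Real.log (‖F t‖ ^ 2 + ε) ≤
      (∫ x in Iio 0, rayDensity r t x * Real.log (‖F x‖ ^ 2 + ε)) +
        ((∫ x, lineDensity r t x * Real.log (‖F ((x : ℂ) + r * Complex.I)‖ ^ 2 + ε)) +
          ∫ x, lineDensity r t x * Real.log (‖F ((x : ℂ) - r * Complex.I)‖ ^ 2 + ε)) := by
  have h1 := log_normSq_add_le_hpAverage hF (fun z hz => hB z hz.le) hr ht hε
  rw [hpAverage_eq_densities hr ht (fun z => Real.log (‖F z‖ ^ 2 + ε))] at h1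
  · exact h1
  · -- integrability: bounded measurable times `(1+σ²)⁻¹`
    have hM0 : 0 ≤ B := (norm_nonneg _).trans (hB 0 (by simp [hr.le]))
    set K : ℝ := max |Real.log ε| |Real.log (B ^ 2 + ε)| with hK
    have hmeas : AEStronglyMeasurable
        (fun σ => Real.log (‖F (hpBdry r t σ)‖ ^ 2 + ε) / (1 + σ ^ 2)) volume := by
      refine (Measurable.div ?_ ?_).aestronglyMeasurable
      · exact Real.measurable_log.comp (((hF.continuous.measurable.comp
          measurable_hpBdry).norm.pow_const 2).add_const ε)
      · exact measurable_const.add (measurable_id.pow_const 2)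
    refine Integrable.mono' (integrable_inv_one_add_sq.const_mul K) hmeas
      (Filter.Eventually.of_forall fun σ => ?_)
    have hpos : 0 < 1 + σ ^ 2 := by positivity
    rw [Real.norm_eq_abs, abs_div, abs_of_pos hpos, div_eq_mul_inv]
    apply mul_le_mul_of_nonneg_right _ (inv_nonneg.2 hpos.le)
    have hFle := hB _ (abs_im_hpBdry_le (t := t) hr σ)
    have hlo : Real.log ε ≤ Real.log (‖F (hpBdry r t σ)‖ ^ 2 + ε) :=
      Real.log_le_log hε (by nlinarith [norm_nonneg (F (hpBdry r t σ))])
    have hhi : Real.log (‖F (hpBdry r t σ)‖ ^ 2 + ε) ≤ Real.log (B ^ 2 + ε) :=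
      Real.log_le_log (by nlinarith [norm_nonneg (F (hpBdry r t σ))])
        (by nlinarith [norm_nonneg (F (hpBdry r t σ))])
    rw [abs_le]
    constructor
    · have : |Real.log ε| ≤ K := le_max_left _ _
      have := neg_abs_le (Real.log ε)
      linarith
    · have : |Real.log (B ^ 2 + ε)| ≤ K := le_max_right _ _
      have := le_abs_self (Real.log (B ^ 2 + ε))
      linarith

end strip

end Literature.Analysis.Complex
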